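import Mathlib
import Summits.NavierStokesRegularity.NavierStokesRegularity.Theorems.ThreadingFluxHorizonTowerFiniteTowerDefs
import Summits.NavierStokesRegularity.NavierStokesRegularity.Theorems.ThreadingFluxHorizonTowerFiniteTowerEvenPair
import HarnessLib

/-!
# Crux `PoloidalLiouville` (stmt-NavierStokesRegularity-1222), crux idea «horizon-threading-tower» (ns-idea-15):
# `FiniteTowerGcdTwoTopHorizonTowerZonality` BY NAME (THM H, the second cone digit)

Support file (`--supports stmt-NavierStokesRegularity-1222`, helper; cell `ns-wall-extremal`, width hand ns-wall-eng-3 g5; 0 kit).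
The typed statement (`Theorems/ThreadingFluxHorizonTowerFiniteTowerDefs.lean`, append VI) is closed by name from
`finiteTower_zonalForm_of_evenPair` (`…FiniteTowerEvenPair`): the Defs-shaped binders (`D := K.max'`, `D′ := (K.erase D).max'`,
`Nat.gcd D D′ = 2`, `4 ≤ D′`) are unfolded into the working binders (`D = 2(n+2)`, `D′ = 2(m+2)`, `m < n`, `m+2 ⊥ n+2`, `D ∈ K`
maximal, `D′` second largest).
HONEST LABEL: an infinite family of special cases of the crux-idea conjecture `HorizonTowerZonality` (finite towers, order one, a
side condition on the top pair); general finite towers, general towers, `PoloidalLiouville` (1222) OPEN; W1 movement 0; NS regularity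
NOT proved.
-/

-- the summit and its single sub-problem share the name (CONVENTIONS §1)
set_option linter.dupNamespace false

noncomputable section

namespace Summit.NavierStokesRegularity.NavierStokesRegularity.Theorems.PoloidalLiouville.HorizonTower

/-- ★★ `FiniteTowerGcdTwoTopHorizonTowerZonality` BY NAME (THM H, top pair with `gcd = 2`, no shell of degree `D′ − 2`). -/
theorem finiteTowerGcdTwoTopHorizonTowerZonality : FiniteTowerGcdTwoTopHorizonTowerZonality := by
  intro K H hK hK' hK1 hH hhom hharm hD0 hD'0 hgcd h4 hgap hL1
  set D := K.max' hK with hDdef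
  set D' := (K.erase D).max' hK' with hD'def
  have hD : D ∈ K := Finset.max'_mem K hK
  have hmax : ∀ l ∈ K, l ≤ D := fun l hl => Finset.le_max' K l hl
  have hD'e : D' ∈ K.erase D := Finset.max'_mem _ hK'
  have hD' : D' ∈ K := Finset.mem_of_mem_erase hD'e
  have hlt : D' < D := lt_of_le_of_ne (hmax D' hD') (Finset.ne_of_mem_erase hD'e)
  have hsec : ∀ l ∈ K, l ≠ D → l ≤ D' := fun l hl hne => Finset.le_max' _ l (Finset.mem_erase.mpr ⟨hne, hl⟩)
  -- `D = 2(n+2)`, `D′ = 2(m+2)`, `m < n`, `m + 2 ⊥ n + 2`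
  obtain ⟨a, ha⟩ : 2 ∣ D := hgcd ▸ Nat.gcd_dvd_left D D'
  obtain ⟨b, hb⟩ : 2 ∣ D' := hgcd ▸ Nat.gcd_dvd_right D D'
  obtain ⟨n, rfl⟩ : ∃ n, a = n + 2 := ⟨a - 2, by omega⟩
  obtain ⟨m, rfl⟩ : ∃ m, b = m + 2 := ⟨b - 2, by omega⟩
  have hmn : m < n := by omega
  have hcop : (m + 2).Coprime (n + 2) := by
    have h2 : Nat.gcd D D' = 2 * Nat.gcd (n + 2) (m + 2) := by rw [ha, hb, Nat.gcd_mul_left]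
    rw [hgcd] at h2
    rw [Nat.Coprime, Nat.gcd_comm]
    omega
  rw [ha] at hD hmax hsec hD0
  rw [hb] at hD' hsec hgap hD'0
  exact finiteTower_zonalForm_of_evenPair K H hK1 hH hhom hharm hL1 hmn hcop hD hD' hmax hsec hgap hD0 hD'0

end Summit.NavierStokesRegularity.NavierStokesRegularity.Theorems.PoloidalLiouville.HorizonTower

end
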